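import Summits.BirchSwinnertonDyer.BirchSwinnertonDyer.Theorems.PrintCFramBottomClassIndexLawFiveLeBernoulliUnitsAvatars
import HarnessLib

/-!
# Crux `PrintCFram.BottomClassIndexLawFiveLe` (stmt-BirchSwinnertonDyer-20372), line `eisenstein-resource-bdp-line` (registry v12/v13,
# stub `stub_lineDictionary`): THE BERNOULLI UNITS OF THE KRIZ–LI DATUM, part E — THE `ε ↔ ε_K` DICTIONARY ON `Γ_ℚ` FROM ITS
# FROBENIUS VALUES: prime-value agreement `Teich(b_ε(ℓ)) = ε_K(ℓ)` upgrades to the POINTWISE avatar `Teich(ε τ) = ε_K(χ_d τ)`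
# (cell `bsd-print-cfram`, width seat `bsd-line-cfram-p1-w3` g4; THEOREMS ONLY, `--supports` 20372; BSD is not proved by any of this)

HONEST FRAMING. Nothing here is a statement about BSD; no stub of the skeleton is closed. LEAD g9's request (a) (STATUS 18:36Z): the
Dirichlet avatar of the lift `r·ε` needs the dictionary between the quadratic Galois character `ε` of `K''` on `Γ_ℚ` and Kriz–Li's
Dirichlet `ε_K` — POINTWISE on `Γ_ℚ`, `Teich(ε τ) = ε_K(χ_{|d_K|} τ)` (the hypothesis `hεav` of part A's `avatar_of_lift_psiEps` /
`…InvOmegaEps`). The Galois side supplies (KW for the open-kernel character `ε`, as T1 did for `r`) a factorisation `ε = b_ε ∘ χ_n`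
and (Frobenius: `ε(Frob_ℓ) = 1 ⟺ ℓ` splits in `K'' ⟺ ε_K(ℓ) = 1`, `IsKroneckerCharacterOf`) the agreement AT PRIMES
`Teich(b_ε(ℓ)) = ε_K(ℓ)` for `ℓ ∤ N`. THIS FILE does the rest, Dirichlet-side: the Teichmüller lift of `b_ε` is a Dirichlet character
mod `n` agreeing with `ε_K` at those primes, hence (part III `changeLevel_eq_of_forall_prime_apply_eq`, Dirichlet's theorem) with
`ε_K` at a common level, hence pointwise at `χ_n τ` / `χ_d τ` (part A `changeLevel_apply_modNCyclotomicCharacter`).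

* `teichmullerLift_changeLevel_eq_of_forall_prime` (the Teichmüller lift of `b_ε` and `ε_K` have the same lift to level `n·d`);
* **`teich_apply_eq_of_forall_prime`** (`∀ τ, Teich(b_ε(χ_n τ)) = ε_K(χ_d τ)`), **`teich_eps_avatar_of_forall_prime`** (with `ε = b_ε ∘ χ_n`:
  `∀ τ, Teich(ε τ) = ε_K(χ_d τ)`).

beyond-print theorem: NO. References: [Washington1997] Thm. 14.1, §5.1, Ch. 3; [KrizLi2019] §2 (p. 12, `ε_K`).
-/

set_option autoImplicit false
set_option linter.dupNamespace false

noncomputable section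

open scoped Classical
open NumberField Field
open DirichletCharacter Literature.NumberTheory.LFunctions Literature.NumberTheory.EllipticCurves.KrizLi2019
  Literature.NumberTheory.EllipticCurves Literature.NumberTheory.GaloisRepresentations

namespace Summit.BirchSwinnertonDyer.BirchSwinnertonDyer.Theorems.PrintCFram.BernoulliUnits

open Summit.BirchSwinnertonDyer.BirchSwinnertonDyer.Theorems.PrintCFram

variable {p : ℕ} [hp : Fact p.Prime] {n d : ℕ} [NeZero n] [NeZero d]

/-- **The Teichmüller lift of `b_ε` and `ε_K` agree at a common level** as soon as `Teich(b_ε(ℓ)) = ε_K(ℓ)` for every prime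
`ℓ ∤ N` coprime to `n·d` (Dirichlet's theorem, part III `changeLevel_eq_of_forall_prime_apply_eq`).
[cite: Washington1997, Ch. 3 and §5.1] -/
theorem teichmullerLift_changeLevel_eq_of_forall_prime (bε : (ZMod n)ˣ →* (ZMod p)ˣ) {Λ : DirichletCharacter ℚ_[p] n}
    (hΛ : ∀ u : (ZMod n)ˣ, Λ (u : ZMod n) = (((Kato2004.teichmullerChar p (bε u) : ℤ_[p]ˣ) : ℤ_[p]) : ℚ_[p]))
    (εK : DirichletCharacter ℚ_[p] d) {N : ℕ} (hN : N ≠ 0)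
    (hprime : ∀ ℓ : ℕ, ℓ.Prime → ¬ ℓ ∣ N → ∀ hℓ : ℓ.Coprime (n * d),
      (((Kato2004.teichmullerChar p (bε (ZMod.unitOfCoprime ℓ (hℓ.coprime_dvd_right (dvd_mul_right n d)))) : ℤ_[p]ˣ) :
        ℤ_[p]) : ℚ_[p]) = εK (ℓ : ZMod d)) :
    changeLevel (dvd_mul_right n d) Λ = changeLevel (dvd_mul_left d n) εK := by
  haveI : NeZero (n * d) := ⟨Nat.mul_ne_zero (NeZero.ne n) (NeZero.ne d)⟩
  refine changeLevel_eq_of_forall_prime_apply_eq (dvd_mul_right n d) (dvd_mul_left d n) Λ εK hN (fun ℓ hℓ hℓN hcop => ?_)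
  have hu : (ℓ : ZMod n) = (ZMod.unitOfCoprime ℓ (hcop.coprime_dvd_right (dvd_mul_right n d)) : ZMod n) :=
    (ZMod.coe_unitOfCoprime ℓ _).symm
  rw [hu, hΛ, hprime ℓ hℓ hℓN hcop]

/-- **`Teich(b_ε(χ_n τ)) = ε_K(χ_d τ)` for every `τ ∈ Γ_ℚ`**, from the agreement at primes. [cite: Washington1997, Thm. 14.1 and §5.1] -/
theorem teich_apply_eq_of_forall_prime (bε : (ZMod n)ˣ →* (ZMod p)ˣ) (εK : DirichletCharacter ℚ_[p] d) {N : ℕ} (hN : N ≠ 0)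
    (hprime : ∀ ℓ : ℕ, ℓ.Prime → ¬ ℓ ∣ N → ∀ hℓ : ℓ.Coprime (n * d),
      (((Kato2004.teichmullerChar p (bε (ZMod.unitOfCoprime ℓ (hℓ.coprime_dvd_right (dvd_mul_right n d)))) : ℤ_[p]ˣ) :
        ℤ_[p]) : ℚ_[p]) = εK (ℓ : ZMod d))
    (τ : absoluteGaloisGroup ℚ) :
    (((Kato2004.teichmullerChar p (bε (modNCyclotomicCharacter ℚ n τ)) : ℤ_[p]ˣ) : ℤ_[p]) : ℚ_[p]) =
      εK ((modNCyclotomicCharacter ℚ d τ : (ZMod d)ˣ) : ZMod d) := by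
  haveI : NeZero (n * d) := ⟨Nat.mul_ne_zero (NeZero.ne n) (NeZero.ne d)⟩
  obtain ⟨Λ, hΛ⟩ := HerbrandLineCharacters.exists_teichmuller_dirichletCharacter p bε
  have h := teichmullerLift_changeLevel_eq_of_forall_prime bε hΛ εK hN hprime
  rw [← hΛ, ← changeLevel_apply_modNCyclotomicCharacter (dvd_mul_right n d) Λ τ, h,
    changeLevel_apply_modNCyclotomicCharacter]

/-- **THE `ε ↔ ε_K` DICTIONARY ON `Γ_ℚ` (LEAD g9's (a), Dirichlet half).** If the quadratic Galois character `ε` of `K''` factors as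
`ε = b_ε ∘ χ_n` (Kronecker–Weber) and `Teich(b_ε(ℓ)) = ε_K(ℓ)` at every prime `ℓ ∤ N` coprime to `n·d` (Frobenius + `IsKroneckerCharacterOf`),
then POINTWISE `Teich(ε τ) = ε_K(χ_d τ)` — the hypothesis `hεav` of part A. [cite: Washington1997, Thm. 14.1 and §5.1]
[cite: KrizLi2019, §2 (p. 12, ε_K)] -/
theorem teich_eps_avatar_of_forall_prime (e : absoluteGaloisGroup ℚ →* (ZMod p)ˣ) (bε : (ZMod n)ˣ →* (ZMod p)ˣ)
    (he : ∀ τ : absoluteGaloisGroup ℚ, e τ = bε (modNCyclotomicCharacter ℚ n τ))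
    (εK : DirichletCharacter ℚ_[p] d) {N : ℕ} (hN : N ≠ 0)
    (hprime : ∀ ℓ : ℕ, ℓ.Prime → ¬ ℓ ∣ N → ∀ hℓ : ℓ.Coprime (n * d),
      (((Kato2004.teichmullerChar p (bε (ZMod.unitOfCoprime ℓ (hℓ.coprime_dvd_right (dvd_mul_right n d)))) : ℤ_[p]ˣ) :
        ℤ_[p]) : ℚ_[p]) = εK (ℓ : ZMod d))
    (τ : absoluteGaloisGroup ℚ) :
    (((Kato2004.teichmullerChar p (e τ) : ℤ_[p]ˣ) : ℤ_[p]) : ℚ_[p]) = εK ((modNCyclotomicCharacter ℚ d τ : (ZMod d)ˣ) : ZMod d) := by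
  rw [he]; exact teich_apply_eq_of_forall_prime bε εK hN hprime τ

end Summit.BirchSwinnertonDyer.BirchSwinnertonDyer.Theorems.PrintCFram.BernoulliUnits

end
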